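import Summits.QuantumFields.BalabanUV.T4Continuum.Support.GaugeTermResolventBounds
import Summits.QuantumFields.BalabanUV.T4Continuum.Spine.CoerciveInverseTower

/-!
# T⁴ programme, spine node NE2 (U1a), tier B row B4.b — COERCIVITY OF THE BACKGROUND SCALAR OPERATOR from the free one:
# `S_U = D_UᴴD_U + Y_U` is `(γ′/2 − α² − y)`-coercive when `S_1 = ∂ᴴ∂ + Y_1` is `γ′`-coercive, `D_U = ∂ + W`, `‖W‖ ≤ α`, `‖Y_U − Y_1‖ ≤ y`

ROUND-2 swarm `t4-ne2-formalise-*`, leaf prover 05, row **B4.b**, supplement to file 2a `GaugeTermResolventBounds` (p208240).  The layer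
bundle `GaugeTermLayer.LayerLaws` (p208738) asks, for the BACKGROUND family, invertibility of every `S_{U,k}` and `‖S_{U,k}⁻¹‖ ≤ g`; the
`U = 1` row B4.c supplies coercivity of the FREE scalar operator only.  This file bridges the two by quadratic forms, with no Leibniz rule and
no Fourier analysis:
 * §1 form tools: `|Re⟨x, Yx⟩| ≤ ‖Y‖·‖x‖²` (`abs_re_form_le`), `‖Wf‖² ≤ ‖W‖²‖f‖²` for RECTANGULAR `W` (`nsq_mulVec_le_rect`, via the Gram
   matrix `WᴴW`), the half-parallelogram bound `‖u + v‖² ≥ ‖u‖²/2 − ‖v‖²` (`nsq_add_ge`);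
 * §2 **`coercive_gram_perturb`**: `Coercive γ′ (∂ᴴ∂ + Y_1)`, `Y_1 ⪰ 0`, `‖W‖ ≤ α`, `‖Y_U − Y_1‖ ≤ y` ⟹
   `Coercive (γ′/2 − α² − y) ((∂ + W)ᴴ(∂ + W) + Y_U)`; hence (`CoerciveInverseTower.isUnit_of_coercive`, `opNorm_inv_le_of_coercive`)
   **`isUnit_det_gram_perturb`**, **`opNorm_inv_gram_perturb_le`** `‖S_U⁻¹‖ ≤ (γ′/2 − α² − y)⁻¹` in the small-field regime `α² + y < γ′/2`;
 * §3 **`coercive_kron_one`**: coercivity lifts along `X ↦ X ⊗ 1` (colour components), so the `U = 1` coercivity of row B4.c's `DeltaPs`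
   gives that of `DeltaPs ⊗ₖ 1 = Sop 1 Q_1` (row B4.e's `scalarOp_one`).
These are the `isUnit_S` / `opNorm_G_le` fields of `LayerLaws` for the background family (`GaugeTermPerturbationLaw.perturbationLaws_gaugeTerm`).

HONEST FRAMING (T4-DAG p. 1).  [folklore] finite-dimensional linear algebra, statements OURS; model level when instantiated; GLOBAL small field
(`α² + y < γ′/2` displayed); finite torus, linear layer, operator norm; NOT [B9] (3.23)–(3.26) as printed; NE2 NOT proved; NOT infinite
volume, NOT a mass gap, NOT Clay, NOT summit progress; spine 0/9 unchanged.  HONEST DEPENDENCY: continuum YM on T⁴ ⇐ BetaPertH ∧ nine spine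
estimates (0/9 proved); BetaPertH ⇐ (D1) ∧ (D4) ∧ CAP+tail; G-an2-4 gates asym, D1 and NE2/3/4.  ABSOLUTE RULE kept; no `sorry`.
-/

noncomputable section

open scoped BigOperators ComplexConjugate Matrix Matrix.Norms.L2Operator Kronecker ComplexOrder

namespace Summit.QuantumFields.BalabanUV.T4Continuum.GaugeTermCoercivity

open Literature.MathematicalPhysics.QuantumFieldTheory.Balaban1983to89.B5Prop11Lower (nsq nsq_nonneg nsq_mulVec_le norm_form_le
  star_dotProduct_self norm_star_dotProduct_le)
open Summit.QuantumFields.BalabanUV.T4Continuum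
open Summit.QuantumFields.BalabanUV.T4Continuum.CoerciveInverseTower (Coercive isUnit_of_coercive opNorm_inv_le_of_coercive)
open Summit.QuantumFields.BalabanUV.T4Continuum.GaugeTermResolventBounds (re_form_gram nsq_le_re_form)

/-! ## §1 Form tools -/

section Forms

variable {σ τ : Type*} [Fintype σ] [DecidableEq σ] [Fintype τ] [DecidableEq τ]

/-- `|Re⟨x, Yx⟩| ≤ ‖Y‖·‖x‖²`. [folklore] -/
theorem abs_re_form_le (Y : Matrix σ σ ℂ) (x : σ → ℂ) : |(star x ⬝ᵥ (Y *ᵥ x)).re| ≤ ‖Y‖ * nsq x := by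
  refine (Complex.abs_re_le_norm _).trans ((norm_form_le Y x x).trans (le_of_eq ?_))
  rw [Real.mul_self_sqrt (nsq_nonneg x)]

omit [DecidableEq τ] in
/-- `‖Wf‖² ≤ ‖W‖²·‖f‖²` for a RECTANGULAR matrix (through the Gram matrix `WᴴW`). [folklore] -/
theorem nsq_mulVec_le_rect (W : Matrix τ σ ℂ) (f : σ → ℂ) : nsq (W *ᵥ f) ≤ ‖W‖ ^ 2 * nsq f := by
  rw [← re_form_gram W f, sq, ← Matrix.l2_opNorm_conjTranspose_mul_self]
  exact (le_abs_self _).trans (abs_re_form_le _ f)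

omit [Fintype σ] [DecidableEq σ] in
/-- the half-parallelogram bound `‖u + v‖² ≥ ‖u‖²/2 − ‖v‖²`. [folklore] -/
theorem nsq_add_ge [Fintype σ] (u v : σ → ℂ) : nsq u / 2 - nsq v ≤ nsq (u + v) := by
  have hpt : ∀ i, ‖u i‖ ^ 2 ≤ 2 * ‖(u + v) i‖ ^ 2 + 2 * ‖v i‖ ^ 2 := by
    intro i
    have h1 : ‖u i‖ ≤ ‖(u + v) i‖ + ‖v i‖ := by
      have := norm_sub_le ((u + v) i) (v i)
      simpa using this
    have h2 : ‖u i‖ ^ 2 ≤ (‖(u + v) i‖ + ‖v i‖) ^ 2 := pow_le_pow_left₀ (norm_nonneg _) h1 2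
    nlinarith [sq_nonneg (‖(u + v) i‖ - ‖v i‖)]
  have hsum : nsq u ≤ 2 * nsq (u + v) + 2 * nsq v := by
    unfold nsq
    rw [Finset.mul_sum, Finset.mul_sum, ← Finset.sum_add_distrib]
    exact Finset.sum_le_sum fun i _ => hpt i
  linarith

end Forms

/-! ## §2 Coercivity of the background scalar operator from the free one -/

section Perturb

variable {σ τ : Type*} [Fintype σ] [DecidableEq σ] [Fintype τ] [DecidableEq τ]

omit [DecidableEq τ] in
/-- **COERCIVITY SURVIVES THE BACKGROUND**: if `S_1 = ∂ᴴ∂ + Y_1` is `γ′`-coercive with `Y_1 ⪰ 0`, and `D_U = ∂ + W` with `‖W‖ ≤ α`,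
`‖Y_U − Y_1‖ ≤ y`, then `S_U = D_UᴴD_U + Y_U` is `(γ′/2 − α² − y)`-coercive:
`Re⟨f, S_Uf⟩ = ‖(∂ + W)f‖² + Re⟨f, Y_Uf⟩ ≥ ½‖∂f‖² − α²‖f‖² + Re⟨f, Y_1f⟩ − y‖f‖² ≥ ½Re⟨f, S_1f⟩ − (α² + y)‖f‖²`. [folklore] -/
theorem coercive_gram_perturb {Dt W : Matrix τ σ ℂ} {Y₁ Yu S₁ Su : Matrix σ σ ℂ} (hS₁ : S₁ = Dtᴴ * Dt + Y₁)
    (hSu : Su = (Dt + W)ᴴ * (Dt + W) + Yu) (hY₁ : Y₁.PosSemidef) {γ' α y : ℝ} (hco : Coercive γ' S₁) (hW : ‖W‖ ≤ α) (hy : ‖Yu - Y₁‖ ≤ y) :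
    Coercive (γ' / 2 - α ^ 2 - y) Su := by
  intro f
  have hα : 0 ≤ α := (norm_nonneg _).trans hW
  -- the free form
  have h1 : (star f ⬝ᵥ (S₁ *ᵥ f)).re = nsq (Dt *ᵥ f) + (star f ⬝ᵥ (Y₁ *ᵥ f)).re := by
    rw [hS₁, Matrix.add_mulVec, dotProduct_add, Complex.add_re, re_form_gram]
  -- the background form
  have h2 : (star f ⬝ᵥ (Su *ᵥ f)).re = nsq ((Dt + W) *ᵥ f) + (star f ⬝ᵥ (Yu *ᵥ f)).re := by
    rw [hSu, Matrix.add_mulVec, dotProduct_add, Complex.add_re, re_form_gram]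
  have hY₁f : 0 ≤ (star f ⬝ᵥ (Y₁ *ᵥ f)).re := by simpa using hY₁.re_dotProduct_nonneg f
  -- `‖(∂ + W)f‖² ≥ ½‖∂f‖² − α²‖f‖²`
  have h3 : nsq (Dt *ᵥ f) / 2 - α ^ 2 * nsq f ≤ nsq ((Dt + W) *ᵥ f) := by
    rw [Matrix.add_mulVec]
    have hWf : nsq (W *ᵥ f) ≤ α ^ 2 * nsq f :=
      (nsq_mulVec_le_rect W f).trans (mul_le_mul_of_nonneg_right (pow_le_pow_left₀ (norm_nonneg _) hW 2) (nsq_nonneg f))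
    linarith [nsq_add_ge (Dt *ᵥ f) (W *ᵥ f)]
  -- `Re⟨f, Y_Uf⟩ ≥ Re⟨f, Y_1f⟩ − y‖f‖²`
  have h4 : (star f ⬝ᵥ (Y₁ *ᵥ f)).re - y * nsq f ≤ (star f ⬝ᵥ (Yu *ᵥ f)).re := by
    have hd : |(star f ⬝ᵥ ((Yu - Y₁) *ᵥ f)).re| ≤ y * nsq f :=
      (abs_re_form_le _ f).trans (mul_le_mul_of_nonneg_right hy (nsq_nonneg f))
    rw [Matrix.sub_mulVec, dotProduct_sub, Complex.sub_re] at hd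
    linarith [neg_abs_le ((star f ⬝ᵥ (Yu *ᵥ f)).re - (star f ⬝ᵥ (Y₁ *ᵥ f)).re)]
  have h5 := hco f
  rw [h1] at h5
  rw [h2]
  nlinarith [h3, h4, hY₁f, nsq_nonneg f]

omit [DecidableEq τ] in
/-- hence `S_U` is invertible in the small-field regime `α² + y < γ′/2`. [folklore] -/
theorem isUnit_det_gram_perturb {Dt W : Matrix τ σ ℂ} {Y₁ Yu S₁ Su : Matrix σ σ ℂ} (hS₁ : S₁ = Dtᴴ * Dt + Y₁)
    (hSu : Su = (Dt + W)ᴴ * (Dt + W) + Yu) (hY₁ : Y₁.PosSemidef) {γ' α y : ℝ} (hco : Coercive γ' S₁) (hW : ‖W‖ ≤ α) (hy : ‖Yu - Y₁‖ ≤ y)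
    (hsmall : α ^ 2 + y < γ' / 2) : IsUnit Su.det :=
  (Matrix.isUnit_iff_isUnit_det _).mp (isUnit_of_coercive (by linarith) (coercive_gram_perturb hS₁ hSu hY₁ hco hW hy))

omit [DecidableEq τ] in
/-- and `‖S_U⁻¹‖ ≤ (γ′/2 − α² − y)⁻¹`. [folklore] -/
theorem opNorm_inv_gram_perturb_le {Dt W : Matrix τ σ ℂ} {Y₁ Yu S₁ Su : Matrix σ σ ℂ} (hS₁ : S₁ = Dtᴴ * Dt + Y₁)
    (hSu : Su = (Dt + W)ᴴ * (Dt + W) + Yu) (hY₁ : Y₁.PosSemidef) {γ' α y : ℝ} (hco : Coercive γ' S₁) (hW : ‖W‖ ≤ α) (hy : ‖Yu - Y₁‖ ≤ y)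
    (hsmall : α ^ 2 + y < γ' / 2) : ‖Su⁻¹‖ ≤ (γ' / 2 - α ^ 2 - y)⁻¹ :=
  opNorm_inv_le_of_coercive (by linarith) (coercive_gram_perturb hS₁ hSu hY₁ hco hW hy)

/-- the free operator itself: `γ′`-coercive ⟹ invertible with `‖S_1⁻¹‖ ≤ γ′⁻¹` (re-export of `CoerciveInverseTower` in this row's
vocabulary). [folklore] -/
theorem free_bounds {S₁ : Matrix σ σ ℂ} {γ' : ℝ} (hγ : 0 < γ') (hco : Coercive γ' S₁) : IsUnit S₁.det ∧ ‖S₁⁻¹‖ ≤ γ'⁻¹ :=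
  ⟨(Matrix.isUnit_iff_isUnit_det _).mp (isUnit_of_coercive hγ hco), opNorm_inv_le_of_coercive hγ hco⟩

end Perturb

/-! ## §3 Coercivity lifts to colour components -/

section Kron

variable {σ o : Type*} [Fintype σ] [DecidableEq σ] [Fintype o] [DecidableEq o]

omit [DecidableEq σ] [DecidableEq o] in
/-- the colour-`c` slice of a vector on `σ × o`. [folklore] -/
theorem nsq_eq_sum_slices (x : σ × o → ℂ) : nsq x = ∑ c, nsq (fun j => x (j, c)) := by
  unfold nsq
  rw [Fintype.sum_prod_type, Finset.sum_comm]

omit [DecidableEq σ] in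
/-- `(X ⊗ 1)x` acts slice by slice. [folklore] -/
theorem kron_one_mulVec_apply (X : Matrix σ σ ℂ) (x : σ × o → ℂ) (i : σ) (c : o) :
    ((X ⊗ₖ (1 : Matrix o o ℂ)) *ᵥ x) (i, c) = (X *ᵥ fun j => x (j, c)) i := by
  simp only [Matrix.mulVec, dotProduct, Fintype.sum_prod_type, Matrix.kronecker_apply, Matrix.one_apply, mul_ite, mul_one, mul_zero,
    ite_mul, zero_mul]
  refine Finset.sum_congr rfl fun j _ => ?_
  rw [Finset.sum_ite_eq Finset.univ c, if_pos (Finset.mem_univ c)]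

omit [DecidableEq σ] in
/-- the form of `X ⊗ 1` is the sum of the slice forms. [folklore] -/
theorem form_kron_one (X : Matrix σ σ ℂ) (x : σ × o → ℂ) :
    star x ⬝ᵥ ((X ⊗ₖ (1 : Matrix o o ℂ)) *ᵥ x) = ∑ c, star (fun j => x (j, c)) ⬝ᵥ (X *ᵥ fun j => x (j, c)) := by
  simp only [dotProduct, Fintype.sum_prod_type, Pi.star_apply, kron_one_mulVec_apply]
  rw [Finset.sum_comm]

omit [DecidableEq σ] in
/-- **COERCIVITY LIFTS ALONG `X ↦ X ⊗ 1`.** [folklore] -/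
theorem coercive_kron_one {γ : ℝ} {X : Matrix σ σ ℂ} (h : Coercive γ X) : Coercive γ (X ⊗ₖ (1 : Matrix o o ℂ)) := by
  intro x
  rw [form_kron_one, Complex.re_sum, nsq_eq_sum_slices, Finset.mul_sum]
  exact Finset.sum_le_sum fun c _ => h _

end Kron

end Summit.QuantumFields.BalabanUV.T4Continuum.GaugeTermCoercivity

end
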